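import Summits.ResolutionOfSingularities.ResolutionOfSingularities.Theorems.PurelyInseparableDim4ResConePowerChain
import Summits.ResolutionOfSingularities.ResolutionOfSingularities.Theorems.PurelyInseparableDim4ResConePowerConeTilt
import HarnessLib
import HarnessLib.Audit.Tags

/-!
# Purely inseparable four-folds — SLICE B along a chain: the TILT LAW and the ALIGNMENT of the birth layer at
# EVERY stage of a constant-`(d, e_G = 3)` stretch (chain form of `…ResConePowerConeTilt`)

[OURS · counted 0 · cell `res-dim4-pi` · K2(p) lane, SLICE B architecture (B2′) (holder res-dim4-p-12 g3:
«p-2 takes PowerChainTilt» 2026-08-28T22:55Z / 22:58Z) · seat res-dim4-p-2 g3 · K lane crit-4 g2 (K-A4).]  Nothing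
here proves K2(p) = `RidgeBudget.NoAboveFloorTrap p p`, `NoIsolatedTrap p p` or resolution of singularities in
dimension ≥ 4 / characteristic `p`.  AI kernel work, weaker than expert review.

`…ResConePowerChain.chain_powerCone_package` (p674751) gives ONE frame along a constant-`(d, e_G = 3)` stretch of an
isolated above-floor `Step0 p` chain: `g_k = a_k · ℓ_k^d`, `resVertex (c k) = ker ℓ_k`, `ℓ_k(j_k) + ℓ_k·b_k = 0`,
`ℓ_{k+1}|_{i ≠ j_k} = λ_k · ℓ_k|` (`λ_k ≠ 0`), leaving ONE free datum per stage, the tilt `ℓ_{k+1}(j_k)`.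
res-dim4-p-12 g3's `…ResConePowerConeTilt` (p675934) reads that datum off the first birth layer `B₁` of the sheared
residual polynomial at ONE step.  Here the step-lemmas are restated along the chain with the chain's band data
(`p < ord₀ (c k) ≤ 2p − 2`, constant natural shade `d`, `x^{r_k} ∣ F_k`, `c (k+1) = step …`) discharged once:

* **`chain_tilt_identity`** — for any frame data at stages `k`, `k+1` (`g_{k+1} = a′ · L′^d`, `ℓ′ = λ ℓ` off `j_k`)
  and every `x_{j_k}`-free `μ` of degree `d − 1`:
  `a′ · d · ℓ′(j_k) · λ^{d−1} · coeff_μ (L̃_k^{d−1}) = c_k · coeff_{μ + 2e_{j_k}} (shear (j k) (b k) G_k)`,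
  `G_k = F_k / x^{r_k}`, `c_k` the (non-zero) top coefficient of the sheared boundary monomial;
* **`chain_tilt_eq_zero_iff`** (`1 ≤ d < p`) — NO TILT at stage `k` (`ℓ′(j_k) = 0`) iff `B₁ = 0`;
* **`chain_births_aligned`** — since `e_G (c (k+1)) = 3` again, `B₁ ∝ L̃_k^{d−1}` at EVERY stage `k ≥ k₀`
  (the alignment necessary condition holds all along the stretch);
* **`chain_powerCone_tilt_package`** — the frame of `chain_powerCone_package` TOGETHER WITH, per stage, an alignment
  scalar `κ_k` (`B₁ = κ_k · L̃_k^{d−1}` coefficientwise) and the tilt identity: the complete per-stage LEDGER INPUT of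
  idea-4's I-4-7 game for slice B, every prime, `1 ≤ d < p`.

[cite: CossartJannsenSaito2020, Thm. 3.10(4), Thm. 3.14, Thm. 9.3]
bears_on: LADDER-RESOLUTION:D157-DOOR2 (res-dim4-pi · K2(p) = `RidgeBudget.NoAboveFloorTrap p p`, slice B).
Supports stmt-ResolutionOfSingularities-16155 (helper).
-/

set_option linter.dupNamespace false -- mandated namespace of this single-conjunct summit

noncomputable section

namespace Summit.ResolutionOfSingularities.ResolutionOfSingularities.Theorems.PIDim4

namespace ResCone

open MvPolynomial Finset
open Literature.AlgebraicGeometry.Resolution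
open Literature.AlgebraicGeometry.Resolution.CentreBlowup
open Literature.AlgebraicGeometry.Resolution.Hauser2010
open Literature.AlgebraicGeometry.Resolution.HauserPerlega2019
open PointBlowup (polarMap additiveSubspace direction)

variable {K : Type} [Field K]

section PowerChainTilt

variable (p : ℕ) [hp : Fact p.Prime] [CharP K p] [DecidableEq K]

omit [CharP K p] in
/-- **Band data with the sharp upper bound** on the constant-shade tail: `ord₀ (c k) = o`, `p < o`,
`o + 1 < 2p` (isolated band `o ≤ 2p − 2`), `o − |r_k| = d`. [OURS] -/
theorem chain_shade_nat' {c : ℕ → State K} (hc : ∀ k, IsIsolated p (c k).F ∧ Step0 p (c k) (c (k + 1)))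
    (hfloor : ∀ k, ordZero (c k).F ≠ p) {k₀ d : ℕ} (hshade : ∀ k, k₀ ≤ k → (c k).shade = (d : ℕ∞)) {k : ℕ}
    (hk : k₀ ≤ k) : ∃ o : ℕ, ordZero (c k).F = o ∧ p < o ∧ o + 1 < 2 * p ∧ o - (c k).r.degree = d := by
  obtain ⟨o, ho, hpo, ho2⟩ := BandShade.exists_ordZero_eq p hc k
  have hp2 : 2 ≤ p := hp.out.two_le
  refine ⟨o, ho, lt_of_le_of_ne hpo (fun h => hfloor k (by rw [ho, h])), by omega, ?_⟩
  have h := hshade k hk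
  rw [BandShade.shade_eq_coe ho] at h
  exact_mod_cast h

omit hp [CharP K p] in
/-- The frame equation at stage `k + 1`, rewritten on the step and with the exponent `o − |r_k|`. [OURS] -/
theorem resForm_step_eq_of_chain {c : ℕ → State K} {j : ℕ → Fin 4} {b : ℕ → Fin 4 → K}
    (hw : FreeTail.IsWitnessedChain p c j b) {k d o : ℕ} (hod : o - (c k).r.degree = d)
    {ℓ' : Fin 4 → K} {a' : K} (hform' : resForm (c (k + 1)) = C a' * (∑ i, C (ℓ' i) * X i) ^ d) :
    resForm (CentreBlowup.step p Finset.univ (j k) (b k) (c k)) =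
      C a' * (∑ i, C (ℓ' i) * X i) ^ (o - (c k).r.degree) := by
  rw [← (hw k).2.2.2.2, hod]
  exact hform'

omit [CharP K p] in
/-- **THE TILT IDENTITY along the chain** (slice B, layer `1`, every stage `k ≥ k₀` of the constant-shade tail):
for frame data `g_{k+1} = a′ · L′^d` with `ℓ′ = λ · ℓ` off the chart letter `j_k`, and every `x_{j_k}`-free `μ` of
degree `d − 1`, `a′ · d · ℓ′(j_k) · λ^{d−1} · coeff_μ (L̃_k^{d−1}) = c_k · coeff_{μ + 2e_{j_k}} (shear (j k) (b k) G_k)`.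
[OURS] [cite: CossartJannsenSaito2020, Thm. 3.10(4), Thm. 9.3] -/
theorem chain_tilt_identity {c : ℕ → State K} {j : ℕ → Fin 4} {b : ℕ → Fin 4 → K}
    (hc : ∀ k, IsIsolated p (c k).F ∧ Step0 p (c k) (c (k + 1))) (hw : FreeTail.IsWitnessedChain p c j b)
    (hr0 : ∀ e ∈ (c 0).F.support, (c 0).r ≤ e) (hfloor : ∀ k, ordZero (c k).F ≠ p) {k₀ d : ℕ}
    (hshade : ∀ k, k₀ ≤ k → (c k).shade = (d : ℕ∞)) {k : ℕ} (hk : k₀ ≤ k)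
    {ℓ ℓ' : Fin 4 → K} {a' lam : K} (hform' : resForm (c (k + 1)) = C a' * (∑ i, C (ℓ' i) * X i) ^ d)
    (hlam : ∀ i, i ≠ j k → ℓ' i = lam * ℓ i) {μ : Fin 4 →₀ ℕ} (hμj : μ (j k) = 0) (hμ : μ.degree + 1 = d) :
    a' * (d : K) * ℓ' (j k) * lam ^ (d - 1) *
        coeff μ ((∑ i, C (Function.update ℓ (j k) 0 i) * X i) ^ (d - 1)) =
      coeff (topMonomial (j k) (b k) (c k).r) (shear (j k) (b k) (monomial (c k).r (1 : K))) *
        coeff (μ + Finsupp.single (j k) 2) (shear (j k) (b k) ((c k).F.divMonomial (c k).r)) := by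
  obtain ⟨o, ho, hpo, ho2, hod⟩ := chain_shade_nat' p hc hfloor hshade hk
  have hr := IsolatedBand.isolated_chain_forall_le hc hr0 k
  have heq := chain_shade_step p hw (d := (d : ℕ∞)) hshade hk
  have hg' := resForm_step_eq_of_chain p hw hod hform'
  have h := powerCone_tilt_identity (j k) (hw k).2.1 ho hr hpo ho2 heq hg' hlam hμj (by rw [hod]; exact hμ)
  rw [hod] at h
  exact h

/-- **NO TILT ⟺ NO FIRST BIRTH LAYER, along the chain** (`1 ≤ d < p`; frame data as in `chain_tilt_identity` with
`λ ≠ 0` and `ℓ` alive off `j_k`): `ℓ′(j_k) = 0 ↔ ∀ x_{j_k}-free μ of degree d − 1, coeff_{μ + 2e_{j_k}} (shear G_k) = 0`.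
[OURS] [cite: CossartJannsenSaito2020, Thm. 3.10(4), Thm. 9.3] -/
theorem chain_tilt_eq_zero_iff {c : ℕ → State K} {j : ℕ → Fin 4} {b : ℕ → Fin 4 → K}
    (hc : ∀ k, IsIsolated p (c k).F ∧ Step0 p (c k) (c (k + 1))) (hw : FreeTail.IsWitnessedChain p c j b)
    (hr0 : ∀ e ∈ (c 0).F.support, (c 0).r ≤ e) (hfloor : ∀ k, ordZero (c k).F ≠ p) {k₀ d : ℕ}
    (hd1 : 1 ≤ d) (hdp : d < p) (hshade : ∀ k, k₀ ≤ k → (c k).shade = (d : ℕ∞)) {k : ℕ} (hk : k₀ ≤ k)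
    {ℓ ℓ' : Fin 4 → K} {a' lam : K} (hform' : resForm (c (k + 1)) = C a' * (∑ i, C (ℓ' i) * X i) ^ d)
    (hlam : ∀ i, i ≠ j k → ℓ' i = lam * ℓ i) (hlam0 : lam ≠ 0) (hℓ : ∃ i, i ≠ j k ∧ ℓ i ≠ 0) :
    ℓ' (j k) = 0 ↔ ∀ μ : Fin 4 →₀ ℕ, μ (j k) = 0 → μ.degree + 1 = d →
      coeff (μ + Finsupp.single (j k) 2) (shear (j k) (b k) ((c k).F.divMonomial (c k).r)) = 0 := by
  obtain ⟨o, ho, hpo, ho2, hod⟩ := chain_shade_nat' p hc hfloor hshade hk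
  have hr := IsolatedBand.isolated_chain_forall_le hc hr0 k
  have heq := chain_shade_step p hw (d := (d : ℕ∞)) hshade hk
  have hg' := resForm_step_eq_of_chain p hw hod hform'
  have h := powerCone_apply_self_eq_zero_iff p (j k) (hw k).2.1 ho hr hpo ho2 heq (by rw [hod]; exact hd1)
    (by rw [hod]; exact hdp) hg' hlam hlam0 hℓ
  rw [hod] at h
  exact h

/-- **THE BIRTH LAYER IS ALIGNED AT EVERY STAGE of a constant-`(d, e_G = 3)` stretch** (`d < p`): for any `ℓ ≠ 0`
cutting out `resVertex (c k)`, `B₁ ∝ L̃_k^{d−1}` — because `e_G (c (k+1)) = 3` again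
(`exists_births_eq_mul_of_finrank_step_eq_three` with the chain's band data). [OURS]
[cite: CossartJannsenSaito2020, Thm. 3.10(4), Thm. 3.14, Thm. 9.3] -/
theorem chain_births_aligned {c : ℕ → State K} {j : ℕ → Fin 4} {b : ℕ → Fin 4 → K}
    (hc : ∀ k, IsIsolated p (c k).F ∧ Step0 p (c k) (c (k + 1))) (hw : FreeTail.IsWitnessedChain p c j b)
    (hr0 : ∀ e ∈ (c 0).F.support, (c 0).r ≤ e) (hfloor : ∀ k, ordZero (c k).F ≠ p) {k₀ d : ℕ} (hdp : d < p)
    (hshade : ∀ k, k₀ ≤ k → (c k).shade = (d : ℕ∞))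
    (he3 : ∀ k, k₀ ≤ k → Module.finrank K (resVertex (c k)) = 3) {k : ℕ} (hk : k₀ ≤ k)
    {ℓ : Fin 4 → K} (hV : ∀ w, w ∈ resVertex (c k) ↔ dotProduct ℓ w = 0) (hℓ : ℓ ≠ 0) :
    ∃ κ : K, ∀ μ : Fin 4 →₀ ℕ, μ (j k) = 0 → μ.degree + 1 = d →
      coeff (μ + Finsupp.single (j k) 2) (shear (j k) (b k) ((c k).F.divMonomial (c k).r)) =
        κ * coeff μ ((∑ i, C (Function.update ℓ (j k) 0 i) * X i) ^ (d - 1)) := by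
  obtain ⟨o, ho, hpo, ho2, hod⟩ := chain_shade_nat' p hc hfloor hshade hk
  have hr := IsolatedBand.isolated_chain_forall_le hc hr0 k
  have heq := chain_shade_step p hw (d := (d : ℕ∞)) hshade hk
  have he' : Module.finrank K (resVertex (CentreBlowup.step p Finset.univ (j k) (b k) (c k))) = 3 := by
    rw [← (hw k).2.2.2.2]; exact he3 (k + 1) (by omega)
  have h := exists_births_eq_mul_of_finrank_step_eq_three p (j k) (hw k).2.1 ho hr hpo ho2 heq
    (by rw [hod]; exact hdp) hV hℓ he'
  rw [hod] at h
  exact h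

/-- **THE POWER-CONE PACKAGE WITH TILT AND ALIGNMENT** (slice B, `1 ≤ d < p`; the complete per-stage ledger
input): ONE frame `ℓ k, a k, λ k` as in `chain_powerCone_package`, plus alignment scalars `κ k`, such that for every
`k ≥ k₀`: (frame) `ℓ k ≠ 0`, `resVertex (c k) = ker (ℓ k)`, `resForm (c k) = C (a k) * (Σ C (ℓ k i) Xᵢ)^d`,
`ℓ k (j k) + ℓ k ⬝ᵥ b k = 0`, `λ k ≠ 0`, `ℓ (k+1) i = λ k * ℓ k i` (`i ≠ j k`), `∃ i ≠ j k, ℓ k i ≠ 0`;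
(alignment) `coeff_{μ + 2e_{j k}} (shear G_k) = κ k * coeff_μ (L̃_k^{d−1})` for all `x_{j k}`-free `μ` of degree
`d − 1`; (tilt) `a (k+1) · d · ℓ (k+1) (j k) · (λ k)^{d−1} · coeff_μ (L̃_k^{d−1}) = c_k · coeff_{μ + 2e_{j k}} (shear G_k)`
for the same `μ`. [OURS] [cite: CossartJannsenSaito2020, Thm. 3.10(4), Thm. 3.14, Thm. 9.3] -/
theorem chain_powerCone_tilt_package {c : ℕ → State K} {j : ℕ → Fin 4} {b : ℕ → Fin 4 → K}
    (hc : ∀ k, IsIsolated p (c k).F ∧ Step0 p (c k) (c (k + 1))) (hw : FreeTail.IsWitnessedChain p c j b)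
    (hr0 : ∀ e ∈ (c 0).F.support, (c 0).r ≤ e) (hfloor : ∀ k, ordZero (c k).F ≠ p) {k₀ d : ℕ} (hdp : d < p)
    (hshade : ∀ k, k₀ ≤ k → (c k).shade = (d : ℕ∞))
    (he3 : ∀ k, k₀ ≤ k → Module.finrank K (resVertex (c k)) = 3) :
    ∃ (ℓ : ℕ → Fin 4 → K) (a lam κ : ℕ → K), ∀ k, k₀ ≤ k →
      (ℓ k ≠ 0 ∧ (∀ w, w ∈ resVertex (c k) ↔ dotProduct (ℓ k) w = 0) ∧
        resForm (c k) = C (a k) * (∑ i, C (ℓ k i) * X i) ^ d ∧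
        ℓ k (j k) + dotProduct (ℓ k) (b k) = 0 ∧
        lam k ≠ 0 ∧ (∀ i, i ≠ j k → ℓ (k + 1) i = lam k * ℓ k i) ∧
        ∃ i, i ≠ j k ∧ ℓ k i ≠ 0) ∧
      (∀ μ : Fin 4 →₀ ℕ, μ (j k) = 0 → μ.degree + 1 = d →
        coeff (μ + Finsupp.single (j k) 2) (shear (j k) (b k) ((c k).F.divMonomial (c k).r)) =
          κ k * coeff μ ((∑ i, C (Function.update (ℓ k) (j k) 0 i) * X i) ^ (d - 1))) ∧
      (∀ μ : Fin 4 →₀ ℕ, μ (j k) = 0 → μ.degree + 1 = d →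
        a (k + 1) * (d : K) * ℓ (k + 1) (j k) * lam k ^ (d - 1) *
            coeff μ ((∑ i, C (Function.update (ℓ k) (j k) 0 i) * X i) ^ (d - 1)) =
          coeff (topMonomial (j k) (b k) (c k).r) (shear (j k) (b k) (monomial (c k).r (1 : K))) *
            coeff (μ + Finsupp.single (j k) 2) (shear (j k) (b k) ((c k).F.divMonomial (c k).r))) := by
  obtain ⟨ℓ, a, lam, hpack⟩ := chain_powerCone_package p hc hw hr0 hfloor hdp hshade he3
  -- alignment scalars stagewise (junk below `k₀`)
  have hκ : ∀ k, ∃ κ : K, k₀ ≤ k → ∀ μ : Fin 4 →₀ ℕ, μ (j k) = 0 → μ.degree + 1 = d →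
      coeff (μ + Finsupp.single (j k) 2) (shear (j k) (b k) ((c k).F.divMonomial (c k).r)) =
        κ * coeff μ ((∑ i, C (Function.update (ℓ k) (j k) 0 i) * X i) ^ (d - 1)) := by
    intro k
    by_cases hk : k₀ ≤ k
    · obtain ⟨hℓ, hV, -⟩ := hpack k hk
      obtain ⟨κ, hκ⟩ := chain_births_aligned p hc hw hr0 hfloor hdp hshade he3 hk hV hℓ
      exact ⟨κ, fun _ => hκ⟩
    · exact ⟨0, fun h => absurd h hk⟩
  choose κ hκ' using hκ
  refine ⟨ℓ, a, lam, κ, fun k hk => ⟨hpack k hk, hκ' k hk, fun μ hμj hμ => ?_⟩⟩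
  obtain ⟨-, -, -, -, -, hlam, -⟩ := hpack k hk
  obtain ⟨-, -, hform', -⟩ := hpack (k + 1) (by omega)
  exact chain_tilt_identity p hc hw hr0 hfloor hshade hk hform' hlam hμj hμ

end PowerChainTilt

end ResCone

end Summit.ResolutionOfSingularities.ResolutionOfSingularities.Theorems.PIDim4

end
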